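import Literature.Computability.MetaComplexity.HeuristicClasses
import Literature.Computability.MetaComplexity.SchemeEncBricks
import Literature.Computability.MetaComplexity.RandReductionsProofs
import Literature.Computability.MetaComplexity.DistProblemsProofs
import Literature.Computability.Complexity.PRelHierarchy
import HarnessLib

/-!
# `AvgBPP ⊆ HeurBPP`: amplification of randomized heuristic schemes (proofs)

Third sibling proof file of `HeuristicClasses.lean` (D-0014). It discharges
`Literature.Computability.MetaComplexity.AvgBPP_subset_HeurBPP` — randomized errorless heuristic
schemes are randomized heuristic schemes (Bogdanov–Trevisan 2006, §2.3: "for the … randomized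
heuristic classes, we have the standard containments `Avg C ⊆ Heur C`"; arXiv cs/0606037v2, p. 19,
after Def. 15).

## The printed argument and what is proved here

With the inner constant `1/4` of Def. 2.11/2.13 (arXiv Defs. 12, 14) the containment is not a
relabelling: on a good input `x ∈ supp Dₙ` (`Pr_coins[A = ⊥] < 1/4`, `Pr_coins[A = ¬L(x)] ≤ 1/4`)
answering `0` for `⊥` only gives coin error `< 1/2`; the source's remark after Def. 12 (p. 18: run
`k` times, "a majority of the runs that do not output `⊥` will output the correct answer … the
choice of constant `1/4` is arbitrary") closes the gap. It is organised as in
`Complexity/BPPErrorReduction.lean` (iterated majority of *three* runs, exact counting) and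
`RandReductionsProofs.lean` (independent runs read *deinterleaved* coins, `everyOther`, since the
coin budget of a `RandAlg` is an arbitrary function the machine cannot evaluate):

1. *`⊥ ↦` a fresh coin* (`exists_freshCoin`): `A₁(x; s r) = A(x; r)` if `≠ ⊥`, else the coin `s`;
   coin error `w + b/2 ≤ 1/4 + 1/8 = 3/8` on good inputs (`w = Pr[A = ¬L(x)]`, `b = Pr[A = ⊥]`).
2. *One round of majority of three* (`exists_maj3Round`) on the coin blocks `r₀₀, r₁₀, r₀₁` of the
   twice deinterleaved `r ∈ {0,1}^{4m}`; coin error `e ↦ e²(3 - 2e)` (`cnt_everyOther` twice).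
3. Two rounds: `3/8 ↦ 81/256 ↦ < 0.237 < 1/4`, so the bad inputs of `A₃` inside `supp Dₙ` lie in
   `{x | Pr[A = ⊥] ≥ 1/4}`, of `Dₙ`-probability `≤ 1/m` (`Ensemble.prob_mono`).

*Machines.* No Turing machine is programmed: a scheme-specified PPT algorithm is packaged as the
**total** `FP` function `w ↦ optBoolEnc (A.run (decScheme ⟨w⟩₁) ⟨w⟩₂)` via the normaliser of
`SchemeEncBricks.lean` (`runFn_mem_FP`); all further algorithms are brick terms (`fanoutFn`,
`iteFn`, `everyOther_mem_FP`, `PRelSigma.tail_mem_FP`, two two-state transductions), read back as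
`IsPolyTime schemeEnc encodeBool` (`isPolyTime_of_runFn_mem_FP`). A pure proof file: the
intermediate algorithms are structure literals inside existence statements.

## References

* A. Bogdanov, L. Trevisan, *Average-Case Complexity*, Found. Trends TCS 2 (2006), §2.3,
  Def. 2.11–2.13 and the remarks around them (arXiv cs/0606037v2: Defs. 12–15, pp. 18–19).
* S. Arora, B. Barak, *Computational Complexity: A Modern Approach*, CUP 2009, §7.4.1 and Thm. 7.10
  (error reduction by independent repetitions and majority), §1.3 (composition).
-/

namespace Literature.Computability.MetaComplexity

open _root_.Computability Complexity

/-! ### Two finite-state transductions -/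

/-- `encodeBool b = [b]` (Mathlib's `encodeBool` is `pure`). [folklore] -/
private theorem encodeBool_eq (b : Bool) : encodeBool b = [b] := rfl

/-- **Finite maps on `{0, 1, ⊥}` are polynomial time**: every `g : Option Bool → Bool` is
polynomial-time computable from `optBoolEnc` (`⊥ ↦ [0]`, `b ↦ [1, b]`) to `encodeBool`, by the
transducer answering `[g ⊥]` on a leading `0` and `[g b]` on `1 b` (`FST.polyTimeComputable_eval`).
[Arora–Barak 2009, §1.2 (routine machine)] [folklore] -/
theorem polyTimeComputable_optBoolEnc_map (g : Option Bool → Bool) :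
    PolyTimeComputable optBoolEnc encodeBool g := by
  let T : FST (Option Bool) Bool Bool :=
    ⟨none, fun s c => match s, c with
        | none, false => (some false, [g none])
        | none, true => (some true, [])
        | some true, b => (some false, [g (some b)])
        | some false, _ => (some false, []),
      fun _ => [], fun _ => true⟩
  have hT : ∀ o : Option Bool, T.eval (optBoolEnc o) = encodeBool (g o) := by
    rintro (_ | _ | _) <;> rfl
  obtain ⟨p, M, hM⟩ := T.polyTimeComputable_eval
  refine ⟨p, M, fun o => ?_⟩
  have h := hM (optBoolEnc o)
  rw [show (id (T.eval (optBoolEnc o)) : List Bool) = encodeBool (g o) from hT o] at h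
  exact h

/-- **The head bit is polynomial time**: `r ↦ [r.headD 0] ∈ FP` (emit the first symbol and fall
silent; on the empty word write `[0]` at the end). [Arora–Barak 2009, §1.2] [folklore] -/
theorem headBitFn_mem_FP : (fun r : List Bool => [r.headD false]) ∈ FP := by
  let T : FST Bool Bool Bool :=
    ⟨true, fun s a => (false, bif s then [a] else []), fun s => bif s then [false] else [],
      fun _ => true⟩
  have hrun : ∀ r : List Bool, T.run false r = (false, []) := by
    intro r
    induction r with
    | nil => rfl
    | cons a r ih => simp [FST.run_cons, T, ih]
  have hT : ∀ r : List Bool, T.eval r = [r.headD false] := by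
    rintro (_ | ⟨a, r⟩)
    · rfl
    · simp [FST.eval, FST.run_cons, T, hrun]
  have h : (fun r : List Bool => [r.headD false]) = T.eval := funext fun r => (hT r).symm
  rw [h]
  exact T.polyTimeComputable_eval

/-! ### Scheme-specified randomized algorithms as total `FP` functions -/

section RandAlg
open Literature.Computability.Complexity (RandAlg)
open Literature.Computability.Complexity.RandAlg

/-- **The run map of a PPT randomized scheme is a total `FP` function.** If
`A : RandAlg (List Bool × ℕ × ℕ) β` is polynomial time on the scheme encoding (machine inputs
`⟨⟨x, ⟨1ⁿ, 1ᵐ⟩⟩, r⟩`, outputs through `eb`), then `w ↦ eb (A.run (decScheme ⟨w⟩₁) ⟨w⟩₂) ∈ FP`: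
precompose the machine of `A` with the normaliser `w ↦ ⟨schemeEnc (decScheme ⟨w⟩₁), ⟨w⟩₂⟩`
(`normScheme_mem_FP`, `fanoutFn_mem_FP`, `PolyTimeComputable.comp_holds`), which fixes well-formed
words. [Arora–Barak 2009, §1.3 (composition; representation changes)] [folklore] -/
theorem runFn_mem_FP {β : Type} {eb : β → List Bool} {A : RandAlg (List Bool × ℕ × ℕ) β}
    (hA : A.IsPolyTime schemeEnc eb) :
    (fun w => eb (A.run (decScheme (Brick.fstF w)) (Brick.sndF w))) ∈ FP := by
  have hN : fanoutFn (normScheme ∘ Brick.fstF) Brick.sndF ∈ FP :=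
    fanoutFn_mem_FP (comp_mem_FP normScheme_mem_FP Brick.fstF_mem_FP) Brick.sndF_mem_FP
  have hdec : PolyTimeComputable (id : List Bool → List Bool)
      (fun p : (List Bool × ℕ × ℕ) × List Bool => boolPair (schemeEnc p.1) p.2)
      (fun w => (decScheme (Brick.fstF w), Brick.sndF w)) :=
    PolyTimeComputable.of_encode_eq (f := fanoutFn (normScheme ∘ Brick.fstF) Brick.sndF)
      (ea := id) (eb := id) id (fun _ => rfl)
      (fun w => by simp [normScheme_apply]) hN
  exact PolyTimeComputable.of_encode_eq (f := Function.uncurry A.run ∘ fun w =>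
      (decScheme (Brick.fstF w), Brick.sndF w)) (ea := id) (eb := eb) id (fun _ => rfl)
    (fun _ => rfl) (PolyTimeComputable.comp_holds hA.1 hdec)

/-- A finite post-processing `g : Option Bool → Bool` of a PPT `{0,1,⊥}`-valued randomized scheme
is a total one-bit `FP` function `w ↦ [g (A.run (decScheme ⟨w⟩₁) ⟨w⟩₂)]`
(`polyTimeComputable_optBoolEnc_map`, then `runFn_mem_FP`). [Arora–Barak 2009, §1.3] [folklore] -/
theorem map_runFn_mem_FP {A : RandAlg (List Bool × ℕ × ℕ) (Option Bool)}
    (hA : A.IsPolyTime schemeEnc optBoolEnc) (g : Option Bool → Bool) :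
    (fun w => [g (A.run (decScheme (Brick.fstF w)) (Brick.sndF w))]) ∈ FP := by
  have hA' : (⟨fun q r => g (A.run q r), A.coinLen⟩ : RandAlg (List Bool × ℕ × ℕ) Bool).IsPolyTime
      schemeEnc encodeBool :=
    ⟨PolyTimeComputable.comp_holds (polyTimeComputable_optBoolEnc_map g) hA.1, hA.2⟩
  exact runFn_mem_FP hA'

/-- **Back to machines.** A Boolean randomized scheme whose run map is realised by the total `FP`
function `w ↦ [B.run (decScheme ⟨w⟩₁) ⟨w⟩₂]`, with a polynomially bounded coin budget, is PPT on
the scheme encoding (`decScheme ∘ schemeEnc = id`; same machine). [Arora–Barak 2009, §1.3] [folklore] -/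
theorem isPolyTime_of_runFn_mem_FP {B : RandAlg (List Bool × ℕ × ℕ) Bool}
    (hF : (fun w => [B.run (decScheme (Brick.fstF w)) (Brick.sndF w)]) ∈ FP)
    (hp : ∃ p : Polynomial ℕ, ∀ n, B.coinLen n ≤ p.eval n) : B.IsPolyTime schemeEnc encodeBool :=
  ⟨PolyTimeComputable.of_encode_eq
      (f := fun w => [B.run (decScheme (Brick.fstF w)) (Brick.sndF w)]) (ea := id) (eb := id)
      (fun p : (List Bool × ℕ × ℕ) × List Bool => boolPair (schemeEnc p.1) p.2) (fun _ => rfl)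
      (fun p => by obtain ⟨q, r⟩ := p; simp [encodeBool_eq]) hF,
    hp⟩

/-! ### Step 1: `⊥ ↦` a fresh coin -/

/-- **Guessing the answer for `⊥`.** For a PPT `{0,1,⊥}`-valued randomized scheme `A` there is a
PPT Boolean scheme `A₁` — on coins `s r` (one extra coin in front) answer `A(x; r)` if it is not
`⊥`, and the coin `s` otherwise — with a total `FP` run map and coin error, on every input
`q = (x, 1ⁿ, 1ᵐ)` and for every target bit `c`, exactly
`Pr_coins[A₁ ≠ c] = Pr_coins[A = ¬c] + Pr_coins[A = ⊥] / 2` (split on the first coin, `cnt_succ`);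
the randomized form of the source's "the algorithm can randomly … guess the answer for `⊥`".
[Bogdanov–Trevisan 2006, §2.3 (after Def. 2.13; arXiv cs/0606037v2, p. 19, after Def. 15)]
[cite: BogdanovTrevisan2006, §2.3 (after Def. 2.13)] -/
theorem exists_freshCoin {A : RandAlg (List Bool × ℕ × ℕ) (Option Bool)}
    (hA : A.IsPolyTime schemeEnc optBoolEnc) :
    ∃ B : RandAlg (List Bool × ℕ × ℕ) Bool,
      (fun w => [B.run (decScheme (Brick.fstF w)) (Brick.sndF w)]) ∈ FP ∧
      (∃ p : Polynomial ℕ, ∀ n, B.coinLen n ≤ p.eval n) ∧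
      ∀ (q : List Bool × ℕ × ℕ) (c : Bool),
        B.pr schemeEnc q {b | b ≠ c} = A.pr schemeEnc q {some (!c)} + A.pr schemeEnc q {none} / 2 := by
  refine ⟨⟨fun q r => (A.run q r.tail).getD (r.headD false), fun n => A.coinLen n + 1⟩,
    ?_, ?_, fun q c => ?_⟩
  · -- the run map as a brick term
    set R : List Bool → List Bool := fanoutFn Brick.fstF (List.tail ∘ Brick.sndF) with hR
    have hRFP : R ∈ FP :=
      fanoutFn_mem_FP Brick.fstF_mem_FP (comp_mem_FP PRelSigma.tail_mem_FP Brick.sndF_mem_FP)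
    set S : List Bool → List Bool :=
      (fun w => [(A.run (decScheme (Brick.fstF w)) (Brick.sndF w)).isSome]) ∘ R with hS
    set V : List Bool → List Bool :=
      (fun w => [(A.run (decScheme (Brick.fstF w)) (Brick.sndF w)).getD false]) ∘ R with hV
    set H : List Bool → List Bool := (fun r : List Bool => [r.headD false]) ∘ Brick.sndF with hH
    have hFP : iteFn S V H ∈ FP :=
      iteFn_mem_FP (comp_mem_FP (map_runFn_mem_FP hA Option.isSome) hRFP)
        (comp_mem_FP (map_runFn_mem_FP hA fun o => o.getD false) hRFP)
        (comp_mem_FP headBitFn_mem_FP Brick.sndF_mem_FP)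
    have heq : iteFn S V H = fun w =>
        [(A.run (decScheme (Brick.fstF w)) (Brick.sndF w).tail).getD ((Brick.sndF w).headD false)] := by
      funext w
      have hSw : S w = [(A.run (decScheme (Brick.fstF w)) (Brick.sndF w).tail).isSome] := by
        simp [hS, hR]
      rw [iteFn_apply hSw]
      cases hrun : A.run (decScheme (Brick.fstF w)) (Brick.sndF w).tail with
      | none => simp [hH]
      | some b => simp [hV, hR, hrun]
    rw [heq] at hFP
    exact hFP
  · obtain ⟨p, hp⟩ := hA.2
    exact ⟨p + 1, fun n => by simpa using Nat.add_le_add_right (hp n) 1⟩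
  · -- the coin error, split on the first coin
    rw [RandAlg.pr_eq_uniformProb, RandAlg.pr_eq_uniformProb, RandAlg.pr_eq_uniformProb]
    change uniformProb (A.coinLen (schemeEnc q).length + 1)
        {y | (A.run q y.tail).getD (y.headD false) ∈ {b | b ≠ c}} =
      uniformProb (A.coinLen (schemeEnc q).length) {y | A.run q y ∈ ({some (!c)} : Set _)} +
        uniformProb (A.coinLen (schemeEnc q).length) {y | A.run q y ∈ ({none} : Set _)} / 2
    generalize A.coinLen (schemeEnc q).length = m
    rw [uniformProb_eq_cnt_div, uniformProb_eq_cnt_div, uniformProb_eq_cnt_div, cnt_succ]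
    have h0 : {y : List Bool | false :: y ∈
        {y : List Bool | (A.run q y.tail).getD (y.headD false) ∈ {b | b ≠ c}}} =
          {y | (A.run q y).getD false ≠ c} := rfl
    have h1 : {y : List Bool | true :: y ∈
        {y : List Bool | (A.run q y.tail).getD (y.headD false) ∈ {b | b ≠ c}}} =
          {y | (A.run q y).getD true ≠ c} := rfl
    rw [h0, h1]
    set W : Set (List Bool) := {y | A.run q y ∈ ({some (!c)} : Set (Option Bool))} with hW
    set Bn : Set (List Bool) := {y | A.run q y ∈ ({none} : Set (Option Bool))} with hBn
    have hdisj : Disjoint W Bn := Set.disjoint_left.2 fun y h₁ h₂ => by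
      simp only [hW, hBn, Set.mem_setOf_eq, Set.mem_singleton_iff] at h₁ h₂
      exact Option.some_ne_none _ (h₁.symm.trans h₂)
    have key : cnt m {y | (A.run q y).getD false ≠ c} + cnt m {y | (A.run q y).getD true ≠ c} =
        2 * cnt m W + cnt m Bn := by
      have hcase : ∀ s : Bool, cnt m {y | (A.run q y).getD s ≠ c} =
          if s = c then cnt m W else cnt m W + cnt m Bn := by
        intro s
        split_ifs with hs
        · refine cnt_congr fun y _ => ?_
          simp only [Set.mem_setOf_eq, hW, Set.mem_singleton_iff]
          cases A.run q y with
          | none => subst hs; simp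
          | some b => subst hs; cases b <;> cases s <;> simp
        · rw [← cnt_union_of_disjoint m hdisj]
          refine cnt_congr fun y _ => ?_
          simp only [Set.mem_setOf_eq, Set.mem_union, hW, hBn, Set.mem_singleton_iff]
          cases A.run q y with
          | none => cases s <;> cases c <;> simp_all
          | some b => cases b <;> cases s <;> cases c <;> simp_all
      rw [hcase, hcase]
      cases c <;> simp <;> ring
    have key' : ((cnt m {y | (A.run q y).getD false ≠ c} + cnt m {y | (A.run q y).getD true ≠ c} :
        ℕ) : ℝ) = ((2 * cnt m W + cnt m Bn : ℕ) : ℝ) := by exact_mod_cast key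
    push_cast at key' ⊢
    rw [key', pow_succ]
    field_simp

/-! ### Step 2: one round of majority of three on deinterleaved coins -/

/-- **A free half**: `#{z ∈ {0,1}^{2m} | everyOther true z ∈ E} = #E · 2^m` (product rule
`cnt_everyOther` with the odd half unconstrained). [Arora–Barak 2009, §7.4.1 (independent
repetitions)] [folklore] -/
theorem cnt_everyOther_true (m : ℕ) (E : Set (List Bool)) :
    cnt (m + m) {z | everyOther true z ∈ E} = cnt m E * 2 ^ m := by
  rw [← cnt_univ m, ← cnt_everyOther m E Set.univ]
  exact cnt_congr fun z _ => by simp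

/-- The majority of three bits is wrong iff both of the first two are wrong and the third is right,
or one of the first two and the third are wrong. [Arora–Barak 2009, Thm. 7.10 (proof)] [folklore] -/
private theorem maj3_ne_iff (a b d c : Bool) :
    maj3 a b d ≠ c ↔ (a ≠ c ∧ b ≠ c) ∧ ¬ d ≠ c ∨ (a ≠ c ∨ b ≠ c) ∧ d ≠ c := by
  revert a b d c
  decide

/-- **One round of majority of three for randomized schemes.** For a Boolean randomized scheme
`B` on scheme inputs with a total `FP` run map and a polynomially bounded coin budget `m(N)` there
is another such scheme `B'` — on coins `r ∈ {0,1}^{4 m(N)}` output the majority of `B` run on the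
coin blocks `(r₀)₀, (r₀)₁, (r₁)₀` of the twice deinterleaved string (`everyOther`; `(r₁)₁` is not
used), a brick term (`iteFn` twice) — such that on every input `q` and target bit `c`:
`Pr_coins[B ≠ c] ≤ e ≤ 1` implies `Pr_coins[B' ≠ c] ≤ e² (3 - 2e)`. Counting: with `b = #bad`,
`a = 2^m - b` blocks, the bad coin strings number `2^m (b² a + b (4^m - a²)) = 2^m b² (3·2^m - 2b)`
(`cnt_everyOther`, `cnt_everyOther_true`), and `u ↦ u²(3 - 2u)` is monotone (`sq_mul_three_sub_mono`).
The `k`-run majority of the source's remark after Def. 2.11 with `k = 3`. [Bogdanov–Trevisan 2006,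
§2.3 (remark after Def. 2.11; arXiv cs/0606037v2, p. 18); Arora–Barak 2009, Thm. 7.10]
[cite: BogdanovTrevisan2006, §2.3 (remark after Def. 2.11)] -/
theorem exists_maj3Round {B : RandAlg (List Bool × ℕ × ℕ) Bool}
    (hF : (fun w => [B.run (decScheme (Brick.fstF w)) (Brick.sndF w)]) ∈ FP)
    (hp : ∃ p : Polynomial ℕ, ∀ n, B.coinLen n ≤ p.eval n) :
    ∃ B' : RandAlg (List Bool × ℕ × ℕ) Bool,
      (fun w => [B'.run (decScheme (Brick.fstF w)) (Brick.sndF w)]) ∈ FP ∧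
      (∃ p : Polynomial ℕ, ∀ n, B'.coinLen n ≤ p.eval n) ∧
      ∀ (q : List Bool × ℕ × ℕ) (c : Bool) (e : ℝ), B.pr schemeEnc q {b | b ≠ c} ≤ e → e ≤ 1 →
        B'.pr schemeEnc q {b | b ≠ c} ≤ e ^ 2 * (3 - 2 * e) := by
  refine ⟨⟨fun q r => maj3 (B.run q (everyOther true (everyOther true r)))
      (B.run q (everyOther false (everyOther true r))) (B.run q (everyOther true (everyOther false r))),
    fun n => B.coinLen n + B.coinLen n + (B.coinLen n + B.coinLen n)⟩, ?_, ?_, fun q c e he he1 => ?_⟩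
  · -- the run map as a brick term
    set F : List Bool → List Bool := fun w => [B.run (decScheme (Brick.fstF w)) (Brick.sndF w)]
      with hFdef
    set P : Bool → Bool → List Bool → List Bool := fun i j =>
      fanoutFn Brick.fstF (everyOther i ∘ everyOther j ∘ Brick.sndF) with hP
    have hPFP : ∀ i j, F ∘ P i j ∈ FP := fun i j =>
      comp_mem_FP hF (fanoutFn_mem_FP Brick.fstF_mem_FP
        (comp_mem_FP (everyOther_mem_FP i) (comp_mem_FP (everyOther_mem_FP j) Brick.sndF_mem_FP)))
    have hPw : ∀ (i j : Bool) (w : List Bool), (F ∘ P i j) w =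
        [B.run (decScheme (Brick.fstF w)) (everyOther i (everyOther j (Brick.sndF w)))] := by
      intro i j w
      simp [hFdef, hP]
    have hFP : iteFn (F ∘ P true true) (iteFn (F ∘ P false true) (fun _ => [true]) (F ∘ P true false))
        (iteFn (F ∘ P false true) (F ∘ P true false) (fun _ => [false])) ∈ FP :=
      iteFn_mem_FP (hPFP true true)
        (iteFn_mem_FP (hPFP false true) (const_mem_FP [true]) (hPFP true false))
        (iteFn_mem_FP (hPFP false true) (hPFP true false) (const_mem_FP [false]))
    have heq : iteFn (F ∘ P true true) (iteFn (F ∘ P false true) (fun _ => [true]) (F ∘ P true false))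
        (iteFn (F ∘ P false true) (F ∘ P true false) (fun _ => [false])) = fun w =>
        [maj3 (B.run (decScheme (Brick.fstF w)) (everyOther true (everyOther true (Brick.sndF w))))
          (B.run (decScheme (Brick.fstF w)) (everyOther false (everyOther true (Brick.sndF w))))
          (B.run (decScheme (Brick.fstF w)) (everyOther true (everyOther false (Brick.sndF w))))] := by
      funext w
      have e₁ := hPw true true w; have e₂ := hPw false true w
      have e₃ : F (P true false w) = _ := hPw true false w
      generalize B.run (decScheme (Brick.fstF w)) (everyOther true (everyOther true (Brick.sndF w))) = a
        at e₁ ⊢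
      generalize B.run (decScheme (Brick.fstF w)) (everyOther false (everyOther true (Brick.sndF w))) = b
        at e₂ ⊢
      generalize B.run (decScheme (Brick.fstF w)) (everyOther true (everyOther false (Brick.sndF w))) = d
        at e₃ ⊢
      rw [iteFn_apply e₁]
      cases a <;> cases b <;> cases d <;> simp [iteFn_apply e₂, e₃, maj3]
    rw [heq] at hFP
    exact hFP
  · obtain ⟨p, hp⟩ := hp
    refine ⟨p + p + (p + p), fun n => ?_⟩
    simp only [Polynomial.eval_add]
    exact Nat.add_le_add (Nat.add_le_add (hp n) (hp n)) (Nat.add_le_add (hp n) (hp n))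
  · -- the coin error of the majority
    rw [RandAlg.pr_eq_uniformProb] at he ⊢
    change uniformProb (B.coinLen (schemeEnc q).length + B.coinLen (schemeEnc q).length +
        (B.coinLen (schemeEnc q).length + B.coinLen (schemeEnc q).length))
        {r | maj3 (B.run q (everyOther true (everyOther true r)))
          (B.run q (everyOther false (everyOther true r)))
          (B.run q (everyOther true (everyOther false r))) ∈ {b | b ≠ c}} ≤ e ^ 2 * (3 - 2 * e)
    change uniformProb (B.coinLen (schemeEnc q).length) {y | B.run q y ∈ {b | b ≠ c}} ≤ e at he
    generalize B.coinLen (schemeEnc q).length = m at he ⊢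
    set Bad : Set (List Bool) := {y | B.run q y ∈ {b | b ≠ c}} with hBad
    set T : Set (List Bool) := {r | maj3 (B.run q (everyOther true (everyOther true r)))
      (B.run q (everyOther false (everyOther true r)))
      (B.run q (everyOther true (everyOther false r))) ∈ {b | b ≠ c}} with hT
    -- the two-block events on the first deinterleaved half, and the third run on the second
    set G₂ : Set (List Bool) := {z | everyOther true z ∈ Bad ∧ everyOther false z ∈ Bad} with hG₂
    set G₁ : Set (List Bool) := {z | everyOther true z ∈ Bad ∨ everyOther false z ∈ Bad} with hG₁
    set H₀ : Set (List Bool) := {z | everyOther true z ∈ Badᶜ} with hH₀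
    set H₁ : Set (List Bool) := {z | everyOther true z ∈ Bad} with hH₁
    have hsplit : T = {r | everyOther true r ∈ G₂ ∧ everyOther false r ∈ H₀} ∪
        {r | everyOther true r ∈ G₁ ∧ everyOther false r ∈ H₁} := by
      ext r
      simp only [hT, hG₂, hG₁, hH₀, hH₁, hBad, Set.mem_setOf_eq, Set.mem_union, Set.mem_compl_iff]
      exact maj3_ne_iff _ _ _ _
    have hdisj : Disjoint {r : List Bool | everyOther true r ∈ G₂ ∧ everyOther false r ∈ H₀}
        {r | everyOther true r ∈ G₁ ∧ everyOther false r ∈ H₁} :=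
      Set.disjoint_left.2 fun r h₁ h₂ => h₁.2 h₂.2
    have hab : cnt m Bad + cnt m Badᶜ = 2 ^ m := cnt_add_cnt_compl m Bad
    have hG₂c : cnt (m + m) G₂ = cnt m Bad * cnt m Bad := cnt_everyOther m Bad Bad
    have hG₁c : cnt (m + m) G₁ + cnt m Badᶜ * cnt m Badᶜ = 2 ^ (m + m) := by
      rw [← cnt_everyOther m Badᶜ Badᶜ, ← cnt_add_cnt_compl (m + m) G₁]
      congr 1
      exact cnt_congr fun z _ => by simp [hG₁, not_or]
    have hH₀c : cnt (m + m) H₀ = cnt m Badᶜ * 2 ^ m := cnt_everyOther_true m Badᶜ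
    have hH₁c : cnt (m + m) H₁ = cnt m Bad * 2 ^ m := cnt_everyOther_true m Bad
    have hN : cnt (m + m + (m + m)) T =
        cnt m Bad * cnt m Bad * (cnt m Badᶜ * 2 ^ m) + cnt (m + m) G₁ * (cnt m Bad * 2 ^ m) := by
      rw [hsplit, cnt_union_of_disjoint _ hdisj, cnt_everyOther (m + m) G₂ H₀,
        cnt_everyOther (m + m) G₁ H₁, hG₂c, hH₀c, hH₁c]
    -- pass to the reals
    rw [uniformProb_eq_cnt_div] at he
    rw [uniformProb_eq_cnt_div, hN]
    set t : ℝ := (2 : ℝ) ^ m with ht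
    have htpos : 0 < t := by positivity
    have hu0 : 0 ≤ (cnt m Bad : ℝ) / t := by positivity
    have key := sq_mul_three_sub_mono hu0 he he1
    refine le_trans (le_of_eq ?_) key
    have hab' : (cnt m Badᶜ : ℝ) = t - cnt m Bad := by
      have := congrArg (Nat.cast (R := ℝ)) hab
      push_cast at this
      linarith
    have hG₁' : (cnt (m + m) G₁ : ℝ) = t * t - (cnt m Badᶜ : ℝ) * cnt m Badᶜ := by
      have := congrArg (Nat.cast (R := ℝ)) hG₁c
      push_cast [pow_add] at this
      linarith
    have ht4 : (2 : ℝ) ^ (m + m + (m + m)) = t * t * (t * t) := by rw [pow_add, pow_add]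
    rw [ht4]
    push_cast
    rw [hG₁', hab']
    field_simp
    ring

end RandAlg

/-! ### Step 3: two rounds, and the discharge -/

/-- **Discharge of `AvgBPP_subset_HeurBPP`** (randomized errorless heuristic schemes are
randomized heuristic schemes, `AvgBPP ⊆ HeurBPP`). Given the `AvgBPP` witness `A`, take
`A₃ = maj3Round (maj3Round (freshCoin A))` (`exists_freshCoin`, `exists_maj3Round` twice; PPT by
`isPolyTime_of_runFn_mem_FP`). For `x ∈ supp Dₙ` with `Pr_coins[A(x) = ⊥] < 1/4`, errorlessness
(`Pr_coins[A(x) = ¬L(x)] ≤ 1/4`) gives coin errors `≤ 3/8`, `≤ (3/8)²(3 - 3/4) = 81/256`,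
`≤ (81/256)²(3 - 81/128) < 1/4`; hence the bad inputs of `A₃` in `supp Dₙ` are bad inputs of `A`,
of `Dₙ`-probability `≤ 1/m` (`Ensemble.prob_mono`). The printed "standard containment
`Avg C ⊆ Heur C`" for the randomized classes, with the `k`-run majority remark after Def. 2.11 made
explicit. [Bogdanov–Trevisan 2006, §2.3: Def. 2.11–2.13 and the remarks after Def. 2.11 and 2.13
(arXiv cs/0606037v2, Defs. 12–15, pp. 18–19)] [cite: BogdanovTrevisan2006, §2.3 (after Def. 2.13)] -/
theorem AvgBPP_subset_HeurBPP_holds : AvgBPP_subset_HeurBPP := by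
  rintro Q ⟨A, hA, herr, hfail⟩
  obtain ⟨B₁, hF₁, hp₁, hpr₁⟩ := exists_freshCoin hA
  obtain ⟨B₂, hF₂, hp₂, hpr₂⟩ := exists_maj3Round hF₁ hp₁
  obtain ⟨B₃, hF₃, hp₃, hpr₃⟩ := exists_maj3Round hF₂ hp₂
  refine ⟨B₃, isPolyTime_of_runFn_mem_FP hF₃ hp₃, fun n m hm => ?_⟩
  refine le_trans (Q.dist.prob_mono n ?_) (hfail n m hm)
  rintro x ⟨hx, hsupp⟩
  simp only [Set.mem_setOf_eq] at hx ⊢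
  by_contra hlt
  rw [not_le] at hlt
  have hw := herr n m x hsupp
  have h₁ : B₁.pr schemeEnc (x, n, m) {b | b ≠ Q.lang.boolIndicator x} ≤ 3 / 8 := by
    rw [hpr₁]
    linarith
  have h₂ := hpr₂ (x, n, m) (Q.lang.boolIndicator x) (3 / 8) h₁ (by norm_num)
  have h₃ := hpr₃ (x, n, m) (Q.lang.boolIndicator x) _ h₂ (by norm_num)
  have hnum : (((3 : ℝ) / 8) ^ 2 * (3 - 2 * (3 / 8))) ^ 2 *
      (3 - 2 * ((3 / 8) ^ 2 * (3 - 2 * (3 / 8)))) < 1 / 4 := by norm_num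
  linarith

end Literature.Computability.MetaComplexity
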